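import Summits.QuantumAdvantage.AdviceFreeQNC0.RegisterChainLocal
import Summits.QuantumAdvantage.AdviceFreeQNC0.RingLinFormsLocalGlue
import HarnessLib

/-!
# Cell qa-qnc0, `p = 3` — **`twistBoundX3Local : TwistBoundX3Local`** PROVED (prover qn-prover-3 g22; the assembly
`twistBoundX3Local_of` of planner qa-qnc0-p1 g20, `exp20/Sketch20x.lean` §7, statement VERBATIM in `BondTwistLocal.lean`)

For every radius `r` there are `A, ρ < 1` such that for EVERY `N`, every `r`-LOCAL bell rule `t` (in the `tGuess` frame) and every
`γ ∈ (ℤ/3)^N`, the correlation of the win indicator of the strategy `tGuess ⊕ t` on the odd class with the x-linear phase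
`e₃(Σ_{i : x_i} γ_i)` is `≤ A·ρ^{#supp γ}·2^N`.

Proof (this file = the norm bookkeeping; the path-sum identity is `RegisterChainLocal.pointwise_eq`):
* `core_bound` — for a `τ`-resolved sign weight, `‖Σ_u …‖ ≤ Σ_{a ∈ {0,1}^{2r}} 2ⁿ·|(T_0 ⋯ T_{n−1} f_a)(initState)| ≤ 4^r·3·2^r·ρ^{cnt}·2ⁿ`
  by the path-sum identity (`sum_pathW_eq`, re-indexed by the letters `sum_letters`), one entry `≤ ℓ²` norm, the BLOCK DECAY
  `rnsq_chainFrom_le_pow` (block lemma `blockOpR_contracts` at every twisted middle site followed by `2r` middle sites, greedy) and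
  `rnsq f_a ≤ 6·4^r`;
* `card_supp_le` — all but `4r + 1` points of `supp γ` are admissible block starts, so `(2r+1)·cnt ≥ #supp γ − 4r − 1`
  (`card_starts_le`);
* `twistBoundX3Local` — transport to walk coordinates (`sum_odd_eq_sum_u`, `rel_iff_ringWinU`), `[WIN] = (1 − (−1)^{WIN})/2`,
  `(−1)^{WIN} = Σ_τ [st u n = τ]·Π_k (±1)` (`winSign_eq_sum`), two core bounds (the rule `t` and the empty rule), and the rate
  `ρ' = max(1 − (1−ρ)/(2r+1), 1/2)` with `ρ ≤ ρ'^{2r+1}` (Bernoulli); small `N ≤ 4r + 3` by the trivial bound.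

Consequence: `RingLinFormsLocalGlue.ringLinFormsLocalLt3_of twistBoundX3Local` — the rung R-lin3 ⊗ R-loc `RingLinFormsLocalLt3` now
depends on its main term `RingWindowLocalLt3` ONLY (`ringLinFormsLocalLt3_of_window`).
WHAT THIS IS NOT: not quantitative in `r` (`TwistBoundX3LocalQ` open); `RingWindowLocalLt3` open; crux 22907 untouched;
separation NOT moved.
-/

noncomputable section

namespace Summit.QuantumAdvantage.AdviceFreeQNC0

open Finset Literature.Computability.MetaComplexity Literature.Computability.QuantumComplexity
open Literature.Computability.QuantumComplexity.RingHLF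

namespace BondTwist3

open TransferWalk ConstBells TwistedTransfer

variable {n r : ℕ}

/-! ## Block starts of a twist vector -/

/-- The `ℕ`-indexed twist vector (`0` beyond the letters). -/
def gammaN (γ : Fin (n + 1) → ZMod 3) (j : ℕ) : ZMod 3 := if h : j < n + 1 then γ ⟨j, h⟩ else 0

/-- Admissible block starts: twisted MIDDLE sites `j` (`2r ≤ j`) with room for `2r` more middle sites (`j + 2r + 1 ≤ n`). -/
def bsOf (r n : ℕ) (γ : Fin (n + 1) → ZMod 3) (j : ℕ) : Bool :=
  decide (2 * r ≤ j ∧ j + 2 * r + 1 ≤ n ∧ gammaN γ j ≠ 0)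

/-- The letter phases are cube roots of unity. -/
theorem phase_cube (γ : Fin (n + 1) → ZMod 3) (j : ℕ) : phase γ j ^ 3 = 1 := by
  unfold phase
  split_ifs with h
  · exact stdAddChar_cube _
  · exact one_pow 3

/-- At an admissible block start the phase is a PRIMITIVE cube root and the next `2r+1` sites are middle sites. -/
theorem bsOf_spec (γ : Fin (n + 1) → ZMod 3) (j : ℕ) (h : bsOf r n γ j = true) :
    phase γ j ≠ 1 ∧ ∀ m, m < 2 * r + 1 → decide (2 * r ≤ j + m) = true := by
  unfold bsOf at h
  rw [decide_eq_true_eq] at h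
  obtain ⟨h1, h2, h3⟩ := h
  refine ⟨?_, fun m _ => decide_eq_true (by omega)⟩
  have hj : j < n + 1 := by omega
  unfold gammaN at h3; rw [dif_pos hj] at h3
  unfold phase; rw [dif_pos hj]
  exact stdAddChar_ne_one h3

/-- **Counting the block starts**: all but `4r + 1` points of the support are admissible starts with room in `[0, n)`. -/
theorem card_supp_le (γ : Fin (n + 1) → ZMod 3) :
    (univ.filter fun i : Fin (n + 1) => γ i ≠ 0).card ≤
      ((Ico 0 (0 + n)).filter fun j => bsOf r n γ j = true ∧ j + (2 * r + 1) ≤ 0 + n).card + (4 * r + 1) := by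
  classical
  rw [← Finset.card_map Fin.valEmbedding]
  set S := (univ.filter fun i : Fin (n + 1) => γ i ≠ 0).map Fin.valEmbedding with hS
  have hsub : S ⊆ ((Ico 0 (0 + n)).filter fun j => bsOf r n γ j = true ∧ j + (2 * r + 1) ≤ 0 + n) ∪
      (range (2 * r) ∪ Ico (n - 2 * r) (n + 1)) := by
    intro j hj
    rw [hS, mem_map] at hj
    obtain ⟨i, hi, rfl⟩ := hj
    rw [mem_filter] at hi
    have hiv : i.val < n + 1 := i.isLt
    rw [mem_union, mem_union, mem_filter, mem_Ico, mem_range, mem_Ico]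
    by_cases h1 : (i.val : ℕ) < 2 * r
    · exact Or.inr (Or.inl h1)
    · by_cases h2 : n - 2 * r ≤ i.val
      · exact Or.inr (Or.inr ⟨h2, by simp [Fin.valEmbedding_apply]; omega⟩)
      · refine Or.inl ⟨⟨Nat.zero_le _, by simp [Fin.valEmbedding_apply]; omega⟩, ?_, by simp [Fin.valEmbedding_apply]; omega⟩
        unfold bsOf gammaN
        rw [decide_eq_true_eq]
        simp only [Fin.valEmbedding_apply]
        refine ⟨by omega, by omega, ?_⟩
        rw [dif_pos hiv]; exact hi.2
  calc S.card ≤ (((Ico 0 (0 + n)).filter fun j => bsOf r n γ j = true ∧ j + (2 * r + 1) ≤ 0 + n) ∪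
        (range (2 * r) ∪ Ico (n - 2 * r) (n + 1))).card := card_le_card hsub
    _ ≤ ((Ico 0 (0 + n)).filter fun j => bsOf r n γ j = true ∧ j + (2 * r + 1) ≤ 0 + n).card +
        ((range (2 * r)).card + (Ico (n - 2 * r) (n + 1)).card) :=
        (card_union_le _ _).trans (Nat.add_le_add_left (card_union_le _ _) _)
    _ ≤ _ := by rw [card_range, Nat.card_Ico]; omega

/-! ## The core bound -/

/-- **CORE BOUND**: for an `r`-local rule `t`, a guess `τ` and `4r + 3 ≤ n`, the `τ`-resolved twisted sign sum is
`≤ 4^r·(3·2^r)·ρ^{cnt}·2ⁿ`, `cnt` the greedy number of blocks. -/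
theorem core_bound {ρ : ℝ} (hρ0 : 0 ≤ ρ)
    (hblock : ∀ (ζ₀ : ℂ), ζ₀ ^ 3 = 1 → ζ₀ ≠ 1 → ∀ (ω : Fin (2 * r) → ℂ), (∀ j, ω j ^ 3 = 1) →
      ∀ (ε' : Fin (2 * r + 1) → RegState r → Bool → Bool) (g : RegState r → ℂ),
        rnsq (blockOpR ζ₀ ω ε' g) ≤ ρ ^ 2 * rnsq g)
    {t : Fin (n + 1) → (Fin (n + 1) → Bool) → Bool} (hloc : IsLocalRule (n + 1) r t)
    (γ : Fin (n + 1) → ZMod 3) (κ τ : ZMod 3) (hn : 4 * r + 3 ≤ n) :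
    ‖∑ u : Fin n → Bool, (ZMod.stdAddChar (∑ i : Fin (n + 1), if xOfU u i then γ i else 0) : ℂ) *
        ((if st u n = τ then (1 : ℂ) else 0) * ∏ g : Fin (n + 1), sgnF (t g (xOfU u)) κ (st u g.val) τ)‖ ≤
      (4 : ℝ) ^ r * (3 * (2 : ℝ) ^ r) * ρ ^ (cnt (bsOf r n γ) (2 * r + 1) 0 n) * (2 : ℝ) ^ n := by
  classical
  set c := cnt (bsOf r n γ) (2 * r + 1) 0 n with hc
  -- the path-sum identity, summed
  have hsum : ∑ u : Fin n → Bool, (ZMod.stdAddChar (∑ i : Fin (n + 1), if xOfU u i then γ i else 0) : ℂ) *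
        ((if st u n = τ then (1 : ℂ) else 0) * ∏ g : Fin (n + 1), sgnF (t g (xOfU u)) κ (st u g.val) τ) =
      ∑ a : Fin (2 * r) → Bool, (2 : ℂ) ^ n * chainFrom (Wa γ t κ τ a) (fFin γ t κ τ a) 0 n (initState r) := by
    rw [Finset.sum_congr rfl fun u _ => pointwise_eq hloc γ κ τ hn u, Finset.sum_comm]
    refine Finset.sum_congr rfl fun a _ => ?_
    have e1 : ∀ u : Fin n → Bool, pathW (Wa γ t κ τ a) (fFin γ t κ τ a) 0 (initState r) n (xs u) =
        pathW (Wa γ t κ τ a) (fFin γ t κ τ a) 0 (initState r) n (extB (letters u)) :=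
      fun u => pathW_congr _ _ 0 (initState r) n fun m hm => (extB_letters u hm).symm
    rw [Finset.sum_congr rfl fun u _ => e1 u,
      sum_letters (fun b => pathW (Wa γ t κ τ a) (fFin γ t κ τ a) 0 (initState r) n (extB b)), sum_pathW_eq]
  rw [hsum]
  -- each prefix
  have hterm : ∀ a : Fin (2 * r) → Bool,
      ‖(2 : ℂ) ^ n * chainFrom (Wa γ t κ τ a) (fFin γ t κ τ a) 0 n (initState r)‖ ≤ (2 : ℝ) ^ n * (ρ ^ c * (3 * (2 : ℝ) ^ r)) := by
    intro a
    rw [norm_mul, norm_pow, Complex.norm_two]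
    refine mul_le_mul_of_nonneg_left ?_ (by positivity)
    have h1 := norm_sq_le_rnsq (chainFrom (Wa γ t κ τ a) (fFin γ t κ τ a) 0 n) (initState r)
    have h2 := rnsq_chainFrom_le_pow hblock (Wa γ t κ τ a) (fun j => phase γ j) (fun j => epsMid t κ τ j)
      (fun j => decide (2 * r ≤ j)) (bsOf r n γ) (norm_Wa_le γ t κ τ a) (phase_cube γ)
      (fun j hj => Wa_eq_signW γ t κ τ a (of_decide_eq_true hj)) (bsOf_spec γ) (fFin γ t κ τ a) n 0
    have h3 : rnsq (fFin γ t κ τ a) ≤ 6 * (4 : ℝ) ^ r := by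
      have := rnsq_le_card (fFin γ t κ τ a) (norm_fFin_le γ t κ τ a)
      rw [card_regState] at this; exact_mod_cast this
    have h4 : ‖chainFrom (Wa γ t κ τ a) (fFin γ t κ τ a) 0 n (initState r)‖ ^ 2 ≤ (ρ ^ c * (3 * (2 : ℝ) ^ r)) ^ 2 := by
      have e : (ρ ^ c * (3 * (2 : ℝ) ^ r)) ^ 2 = (ρ ^ 2) ^ c * (9 * (4 : ℝ) ^ r) := by
        have h4 : (4 : ℝ) ^ r = ((2 : ℝ) ^ r) ^ 2 := by
          rw [show (4 : ℝ) = 2 ^ 2 by norm_num, ← pow_mul, ← pow_mul, mul_comm]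
        have hρ2 : (ρ ^ 2) ^ c = (ρ ^ c) ^ 2 := by rw [← pow_mul, ← pow_mul, mul_comm]
        rw [h4, hρ2]; ring
      rw [e]
      rw [← hc] at h2
      have hρc : 0 ≤ (ρ ^ 2) ^ c := by positivity
      calc ‖chainFrom (Wa γ t κ τ a) (fFin γ t κ τ a) 0 n (initState r)‖ ^ 2
          ≤ (ρ ^ 2) ^ c * rnsq (fFin γ t κ τ a) := h1.trans h2
        _ ≤ (ρ ^ 2) ^ c * (6 * (4 : ℝ) ^ r) := mul_le_mul_of_nonneg_left h3 hρc
        _ ≤ (ρ ^ 2) ^ c * (9 * (4 : ℝ) ^ r) := by gcongr; norm_num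
    have := abs_le_of_sq_le_sq h4 (by positivity)
    rwa [abs_norm] at this
  calc ‖∑ a : Fin (2 * r) → Bool, (2 : ℂ) ^ n * chainFrom (Wa γ t κ τ a) (fFin γ t κ τ a) 0 n (initState r)‖
      ≤ ∑ a : Fin (2 * r) → Bool, ‖(2 : ℂ) ^ n * chainFrom (Wa γ t κ τ a) (fFin γ t κ τ a) 0 n (initState r)‖ := norm_sum_le _ _
    _ ≤ ∑ _a : Fin (2 * r) → Bool, (2 : ℝ) ^ n * (ρ ^ c * (3 * (2 : ℝ) ^ r)) := sum_le_sum fun a _ => hterm a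
    _ = (4 : ℝ) ^ r * (3 * (2 : ℝ) ^ r) * ρ ^ c * (2 : ℝ) ^ n := by
        rw [sum_const, card_univ, Fintype.card_fun, Fintype.card_bool, Fintype.card_fin, nsmul_eq_mul]
        push_cast
        rw [pow_mul]; ring

/-- The `τ`-resolved weight of the EMPTY rule: `Σ_τ [st u n = τ]·Π 1 = 1`. -/
theorem sum_resolve_empty (κ : ZMod 3) (u : Fin n → Bool) :
    ∑ τ : ZMod 3, (if st u n = τ then (1 : ℂ) else 0) *
        ∏ g : Fin (n + 1), sgnF ((fun (_ : Fin (n + 1)) (_ : Fin (n + 1) → Bool) => false) g (xOfU u)) κ (st u g.val) τ = 1 := by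
  have h1 : ∀ τ : ZMod 3, (∏ g : Fin (n + 1),
      sgnF ((fun (_ : Fin (n + 1)) (_ : Fin (n + 1) → Bool) => false) g (xOfU u)) κ (st u g.val) τ) = 1 :=
    fun τ => prod_eq_one fun g _ => by unfold sgnF; simp
  simp_rw [h1, mul_one]
  rw [Finset.sum_ite_eq univ (st u n) (fun _ => (1 : ℂ)), if_pos (mem_univ _)]

/-- The empty rule is `r`-local. -/
theorem isLocalRule_empty (N r : ℕ) : IsLocalRule N r (fun (_ : Fin N) (_ : Fin N → Bool) => false) :=
  fun _ _ _ _ => rfl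

open scoped Classical in
/-- The trivial bound: the twisted win sum has norm `≤ 2^N`. -/
theorem trivial_bound (N : ℕ) (t : Fin N → (Fin N → Bool) → Bool) (γ : Fin N → ZMod 3) :
    ‖∑ x : Fin N → Bool, (ZMod.stdAddChar (∑ i : Fin N, if x i then γ i else 0) : ℂ) *
        (if (OddZeros x ∧ RingHLF.Rel x (fun k => xor (tGuess x k) (t k x))) then (1 : ℂ) else 0)‖ ≤ (2 : ℝ) ^ N := by
  classical
  refine (norm_sum_le _ _).trans ?_
  have hterm : ∀ x : Fin N → Bool, ‖(ZMod.stdAddChar (∑ i : Fin N, if x i then γ i else 0) : ℂ) *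
      (if (OddZeros x ∧ RingHLF.Rel x (fun k => xor (tGuess x k) (t k x))) then (1 : ℂ) else 0)‖ ≤ 1 := by
    intro x
    rw [norm_mul]
    have h1 : ‖(ZMod.stdAddChar (∑ i : Fin N, if x i then γ i else 0) : ℂ)‖ ≤ 1 := by
      have h3 := stdAddChar_cube (∑ i : Fin N, if x i then γ i else 0)
      have hn : ‖(ZMod.stdAddChar (∑ i : Fin N, if x i then γ i else 0) : ℂ)‖ ^ 3 = 1 := by
        rw [← norm_pow, h3, norm_one]
      exact ((pow_eq_one_iff_of_nonneg (norm_nonneg _) (by norm_num)).1 hn).le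
    have h2 : ‖(if (OddZeros x ∧ RingHLF.Rel x (fun k => xor (tGuess x k) (t k x))) then (1 : ℂ) else 0)‖ ≤ 1 := by
      split_ifs <;> simp
    exact mul_le_one₀ h1 (norm_nonneg _) h2
  refine (sum_le_sum fun x _ => hterm x).trans ?_
  rw [sum_const, card_univ, Fintype.card_fun, Fintype.card_bool, Fintype.card_fin]
  simp

/-! ## The main bound -/

open scoped Classical in
/-- **MAIN BOUND** (`N = n + 1`, `4r + 3 ≤ n`, any block constant `ρ ≥ 0` satisfying the block lemma): the twisted win sum of an
`r`-local rule has norm `≤ 9·8^r·ρ^{cnt}·2ⁿ`, `cnt` the greedy number of blocks of `γ`.  Transport to walk coordinates,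
`[WIN] = (1 − (−1)^{WIN})/2`, resolution over the final walk state, two core bounds. -/
theorem main_bound {ρ : ℝ} (hρ0 : 0 ≤ ρ)
    (hblock : ∀ (ζ₀ : ℂ), ζ₀ ^ 3 = 1 → ζ₀ ≠ 1 → ∀ (ω : Fin (2 * r) → ℂ), (∀ j, ω j ^ 3 = 1) →
      ∀ (ε' : Fin (2 * r + 1) → RegState r → Bool → Bool) (g : RegState r → ℂ),
        rnsq (blockOpR ζ₀ ω ε' g) ≤ ρ ^ 2 * rnsq g)
    {t : Fin (n + 1) → (Fin (n + 1) → Bool) → Bool} (hloc : IsLocalRule (n + 1) r t)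
    (γ : Fin (n + 1) → ZMod 3) (hn : 4 * r + 3 ≤ n) :
    ‖∑ x : Fin (n + 1) → Bool, (ZMod.stdAddChar (∑ i : Fin (n + 1), if x i then γ i else 0) : ℂ) *
        (if (OddZeros x ∧ RingHLF.Rel x (fun k => xor (tGuess x k) (t k x))) then (1 : ℂ) else 0)‖ ≤
      9 * 8 ^ r * ρ ^ (cnt (bsOf r n γ) (2 * r + 1) 0 n) * (2 : ℝ) ^ n := by
  classical
  have hn2 : 2 ≤ n := by omega
  set F : (Fin (n + 1) → Bool) → ℂ := fun x => (ZMod.stdAddChar (∑ i : Fin (n + 1), if x i then γ i else 0) : ℂ) *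
    (if (OddZeros x ∧ RingHLF.Rel x (fun k => xor (tGuess x k) (t k x))) then (1 : ℂ) else 0) with hF
  set y : Fin (n + 1) → (Fin n → Bool) → Bool := fun g u => t g (xOfU u) with hy
  set G : (Fin n → Bool) → ℂ := fun u => (ZMod.stdAddChar (∑ i : Fin (n + 1), if xOfU u i then γ i else 0) : ℂ) *
    (if ringWinU (n + 2) y u = true then (1 : ℂ) else 0) with hG
  have hodd : ∑ x : Fin (n + 1) → Bool, F x =
      ∑ x ∈ (univ.filter fun x : Fin (n + 1) → Bool => (univ.filter fun j : Fin (n + 1) => x j = false).card % 2 = 1),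
        G (uVec x) := by
    rw [← Finset.sum_filter_add_sum_filter_not univ
      (fun x : Fin (n + 1) → Bool => (univ.filter fun j : Fin (n + 1) => x j = false).card % 2 = 1) F]
    have hzero : ∑ x ∈ univ.filter (fun x : Fin (n + 1) → Bool =>
        ¬ (univ.filter fun j : Fin (n + 1) => x j = false).card % 2 = 1), F x = 0 := by
      refine Finset.sum_eq_zero fun x hx => ?_
      rw [mem_filter] at hx
      have : ¬ (OddZeros x ∧ RingHLF.Rel x (fun k => xor (tGuess x k) (t k x))) := fun h => hx.2 h.1
      simp only [hF, this, if_false, mul_zero]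
    rw [hzero, add_zero]
    refine Finset.sum_congr rfl fun x hx => ?_
    rw [mem_filter] at hx
    have hxo : OddZeros x := hx.2
    have hrel := rel_iff_ringWinU hn2 x hx.2 (fun x k => xor (tGuess x k) (t k x))
    have hy' : (fun (g : Fin (n + 1)) (u : Fin n → Bool) =>
        xor (xor (tGuess (xOfU u) g) (t g (xOfU u))) (tGuess (xOfU u) g)) = y := by
      funext g u
      simp only [hy]
      generalize tGuess (xOfU u) g = a
      generalize t g (xOfU u) = d
      cases a <;> cases d <;> rfl
    rw [hy'] at hrel
    simp only [hF, hG, xOfU_uVec hn2 x hx.2]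
    by_cases hr : RingHLF.Rel x (fun k => xor (tGuess x k) (t k x))
    · rw [if_pos ⟨hxo, hr⟩, if_pos (hrel.1 hr)]
    · rw [if_neg (fun h => hr h.2), if_neg (fun h => hr (hrel.2 h))]
  rw [hodd, sum_odd_eq_sum_u hn2 G]
  -- `[WIN] = (1 − (−1)^{WIN})/2`, both resolved over the final state `τ`
  set κ : ZMod 3 := ((n + 2 + 2 * n : ℕ) : ZMod 3) with hκ
  set t0 : Fin (n + 1) → (Fin (n + 1) → Bool) → Bool := fun _ _ => false with ht0
  set E : (Fin n → Bool) → ℂ := fun u => (ZMod.stdAddChar (∑ i : Fin (n + 1), if xOfU u i then γ i else 0) : ℂ) with hE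
  set C1 : ZMod 3 → ℂ := fun τ => ∑ u : Fin n → Bool, E u *
    ((if st u n = τ then (1 : ℂ) else 0) * ∏ g : Fin (n + 1), sgnF (t0 g (xOfU u)) κ (st u g.val) τ) with hC1
  set C2 : ZMod 3 → ℂ := fun τ => ∑ u : Fin n → Bool, E u *
    ((if st u n = τ then (1 : ℂ) else 0) * ∏ g : Fin (n + 1), sgnF (t g (xOfU u)) κ (st u g.val) τ) with hC2
  have hGsplit : ∀ u : Fin n → Bool, G u =
      (E u * (∑ τ : ZMod 3, (if st u n = τ then (1 : ℂ) else 0) *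
          ∏ g : Fin (n + 1), sgnF (t0 g (xOfU u)) κ (st u g.val) τ) -
       E u * (∑ τ : ZMod 3, (if st u n = τ then (1 : ℂ) else 0) *
          ∏ g : Fin (n + 1), sgnF (t g (xOfU u)) κ (st u g.val) τ)) / 2 := by
    intro u
    have hsign := winSign_eq_sum (n + 2) y u
    have hsg : ∀ (τ : ZMod 3) (g : Fin (n + 1)),
        (if (y g u = true ∧ ((n + 2 + 2 * n : ℕ) : ZMod 3) + st u g.val + τ ≠ 0) then (-1 : ℂ) else 1) =
          sgnF (t g (xOfU u)) κ (st u g.val) τ := fun τ g => rfl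
    simp only [hsg] at hsign
    rw [sum_resolve_empty κ u, ← hsign]
    simp only [hG, hE]
    split_ifs <;> ring
  have hGsum : ∑ u : Fin n → Bool, G u = ((∑ τ : ZMod 3, C1 τ) - ∑ τ : ZMod 3, C2 τ) / 2 := by
    simp_rw [hGsplit]
    rw [← Finset.sum_div, Finset.sum_sub_distrib]
    congr 2
    · simp only [hC1]; rw [Finset.sum_comm]; exact sum_congr rfl fun u _ => by rw [Finset.mul_sum]
    · simp only [hC2]; rw [Finset.sum_comm]; exact sum_congr rfl fun u _ => by rw [Finset.mul_sum]
  rw [hGsum, norm_div, Complex.norm_two]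
  -- the two core bounds
  set M : ℝ := (4 : ℝ) ^ r * (3 * (2 : ℝ) ^ r) * ρ ^ (cnt (bsOf r n γ) (2 * r + 1) 0 n) * (2 : ℝ) ^ n with hM
  have hB1 : ∀ τ, ‖C1 τ‖ ≤ M := fun τ => core_bound hρ0 hblock (isLocalRule_empty (n + 1) r) γ κ τ hn
  have hB2 : ∀ τ, ‖C2 τ‖ ≤ M := fun τ => core_bound hρ0 hblock hloc γ κ τ hn
  have h3 : ∀ C : ZMod 3 → ℂ, (∀ τ, ‖C τ‖ ≤ M) → ‖∑ τ : ZMod 3, C τ‖ ≤ 3 * M := by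
    intro C hC
    calc ‖∑ τ : ZMod 3, C τ‖ ≤ ∑ τ : ZMod 3, ‖C τ‖ := norm_sum_le _ _
      _ ≤ ∑ _τ : ZMod 3, M := sum_le_sum fun τ _ => hC τ
      _ = 3 * M := by rw [sum_const, card_univ, ZMod.card]; simp
  have htri := norm_sub_le (∑ τ : ZMod 3, C1 τ) (∑ τ : ZMod 3, C2 τ)
  have hS : ‖(∑ τ : ZMod 3, C1 τ) - ∑ τ : ZMod 3, C2 τ‖ / 2 ≤ 3 * M := by
    have := h3 C1 hB1; have := h3 C2 hB2
    have hM0 : 0 ≤ M := by rw [hM]; positivity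
    linarith
  refine hS.trans (le_of_eq ?_)
  rw [hM, show (8 : ℝ) = 4 * 2 by norm_num, mul_pow]
  ring

/-! ## The theorem -/

/-- **`twistBoundX3Local : TwistBoundX3Local` — PROVED.** -/
theorem twistBoundX3Local : TwistBoundX3Local := by
  classical
  intro r
  obtain ⟨ρ, hρ0, hρ1, hblock⟩ := blockOpR_contracts r
  -- the rate `ρ' = max (1 − (1−ρ)/(2r+1)) (1/2)`, with `ρ ≤ ρ'^{2r+1}`
  set ρ' : ℝ := max (1 - (1 - ρ) / (2 * r + 1)) (1 / 2) with hρ'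
  have hR : (0 : ℝ) < 2 * r + 1 := by positivity
  have hδ : 0 < (1 - ρ) / (2 * r + 1) := div_pos (by linarith) hR
  have hδ1 : (1 - ρ) / (2 * r + 1) ≤ 1 := by
    rw [div_le_one hR]; have : (0 : ℝ) ≤ 2 * r := by positivity
    linarith
  have hρ'1 : ρ' < 1 := max_lt (by linarith) (by norm_num)
  have hρ'pos : 0 < ρ' := lt_of_lt_of_le (by norm_num) (le_max_right _ _)
  have hρρ' : ρ ≤ ρ' ^ (2 * r + 1) := by
    have hb := one_add_mul_le_pow (show (-2 : ℝ) ≤ -((1 - ρ) / (2 * r + 1)) by linarith) (2 * r + 1)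
    have e : (1 : ℝ) + ((2 * r + 1 : ℕ) : ℝ) * -((1 - ρ) / (2 * r + 1)) = ρ := by
      push_cast; field_simp; ring
    rw [e] at hb
    refine hb.trans (pow_le_pow_left₀ (by linarith) ?_ _)
    rw [← sub_eq_add_neg]; exact le_max_left _ _
  have hinv1 : 1 ≤ ρ'⁻¹ := (one_le_inv₀ hρ'pos).2 hρ'1.le
  refine ⟨9 * 8 ^ r * (ρ'⁻¹) ^ (4 * r + 3), ρ', hρ'1, fun N t hloc γ => ?_⟩
  set w := (univ.filter fun i : Fin N => γ i ≠ 0).card with hw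
  have hwN : w ≤ N := (card_filter_le _ _).trans (by simp)
  -- `ρ'^{w ∸ (4r+1)} ≤ (ρ'⁻¹)^{4r+3} · ρ'^w`
  have hrate : ρ' ^ (w - (4 * r + 1)) ≤ (ρ'⁻¹) ^ (4 * r + 3) * ρ' ^ w := by
    have h1 : ρ' ^ (w - (4 * r + 1) + (4 * r + 3)) ≤ ρ' ^ w := pow_le_pow_of_le_one hρ'pos.le hρ'1.le (by omega)
    have h2 : ρ' ^ (w - (4 * r + 1)) = ρ' ^ (w - (4 * r + 1) + (4 * r + 3)) * (ρ'⁻¹) ^ (4 * r + 3) := by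
      rw [pow_add, mul_assoc, ← mul_pow, mul_inv_cancel₀ hρ'pos.ne', one_pow, mul_one]
    rw [h2, mul_comm]
    exact mul_le_mul_of_nonneg_left h1 (by positivity)
  -- small `N`: the trivial bound
  by_cases hN : N ≤ 4 * r + 3
  · refine (trivial_bound N t γ).trans ?_
    have h1 : (1 : ℝ) ≤ (ρ'⁻¹) ^ (4 * r + 3) * ρ' ^ w := by
      have e : (ρ'⁻¹) ^ (4 * r + 3) * ρ' ^ w = (ρ'⁻¹) ^ (4 * r + 3 - w) := by
        rw [show 4 * r + 3 = (4 * r + 3 - w) + w by omega, pow_add, Nat.add_sub_cancel, mul_assoc, ← mul_pow,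
          inv_mul_cancel₀ hρ'pos.ne', one_pow, mul_one]
      rw [e]; exact one_le_pow₀ hinv1
    have h2 : (1 : ℝ) ≤ 9 * 8 ^ r := by
      have : (1 : ℝ) ≤ 8 ^ r := one_le_pow₀ (by norm_num)
      linarith
    have h2N : (0 : ℝ) < (2 : ℝ) ^ N := by positivity
    calc (2 : ℝ) ^ N = 1 * 1 * (2 : ℝ) ^ N := by ring
      _ ≤ (9 * 8 ^ r) * ((ρ'⁻¹) ^ (4 * r + 3) * ρ' ^ w) * (2 : ℝ) ^ N := by gcongr
      _ = 9 * 8 ^ r * (ρ'⁻¹) ^ (4 * r + 3) * ρ' ^ w * (2 : ℝ) ^ N := by ring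
  -- `N = n + 1`, `n ≥ 4r + 3`
  obtain ⟨n, rfl⟩ : ∃ n, N = n + 1 := ⟨N - 1, by omega⟩
  have hn : 4 * r + 3 ≤ n := by omega
  refine (main_bound hρ0 hblock hloc γ hn).trans ?_
  have hcnt : w - (4 * r + 1) ≤ (2 * r + 1) * cnt (bsOf r n γ) (2 * r + 1) 0 n := by
    have h1 := card_starts_le (bsOf r n γ) (show 0 < 2 * r + 1 by omega) n 0
    have h2 := card_supp_le (r := r) γ
    omega
  have hρc : ρ ^ (cnt (bsOf r n γ) (2 * r + 1) 0 n) ≤ (ρ'⁻¹) ^ (4 * r + 3) * ρ' ^ w := by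
    calc ρ ^ (cnt (bsOf r n γ) (2 * r + 1) 0 n)
        ≤ (ρ' ^ (2 * r + 1)) ^ (cnt (bsOf r n γ) (2 * r + 1) 0 n) := pow_le_pow_left₀ hρ0 hρρ' _
      _ = ρ' ^ ((2 * r + 1) * cnt (bsOf r n γ) (2 * r + 1) 0 n) := by rw [pow_mul]
      _ ≤ ρ' ^ (w - (4 * r + 1)) := pow_le_pow_of_le_one hρ'pos.le hρ'1.le hcnt
      _ ≤ (ρ'⁻¹) ^ (4 * r + 3) * ρ' ^ w := hrate
  have h2n : (2 : ℝ) ^ n ≤ (2 : ℝ) ^ (n + 1) := pow_le_pow_right₀ (by norm_num) (by omega)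
  have hK : (0 : ℝ) ≤ 9 * 8 ^ r := by positivity
  calc 9 * 8 ^ r * ρ ^ (cnt (bsOf r n γ) (2 * r + 1) 0 n) * (2 : ℝ) ^ n
      ≤ (9 * 8 ^ r) * ((ρ'⁻¹) ^ (4 * r + 3) * ρ' ^ w) * (2 : ℝ) ^ (n + 1) := by gcongr
    _ = 9 * 8 ^ r * (ρ'⁻¹) ^ (4 * r + 3) * ρ' ^ w * (2 : ℝ) ^ (n + 1) := by ring

/-! ## The rung R-lin3 ⊗ R-loc modulo its main term -/

/-- **Rung R-lin3 ⊗ R-loc, error term discharged**: `RingLinFormsLocalLt3` now follows from its main term `RingWindowLocalLt3`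
alone (`RingLinFormsLocalGlue.ringLinFormsLocalLt3_of`). -/
theorem ringLinFormsLocalLt3_of_window (hW : RingWindowLocalLt3) : RingLinFormsLocalLt3 :=
  ringLinFormsLocalLt3_of twistBoundX3Local hW

end BondTwist3

end Summit.QuantumAdvantage.AdviceFreeQNC0

end
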